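import Mathlib
import HarnessLib
import Literature.Analysis.FluidPDE.RieszPressureModConst

/-!
# Route `PoloidalWindowDoor`, crux `PoloidalWindowRigidity` (stmt-19708), line `sparse_energy` (cstrat g11) —
# stub S1, FILE C (discharge of the window pressure split), piece C3: THE FAR KERNEL IS LIPSCHITZ AT THE DYADIC RATE

Seat ns-poloidal-K2-p2 g10 (successor of the interim LEAD-of-record lineage on 19708; file `--supports`).  Scale-free bounds
for the second derivatives of the far Newton kernel `Γ∞^{r₀,r₁}` (`Literature/Analysis/FluidPDE/NewtonKernel`), which is the
kernel of the harmonic remainder `p₂` of the window pressure split of S1's near-apex bootstrap: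

* `exists_norm_fderiv3_newtonKernel_le` — `‖D³Γ(z)‖ ≤ c / |z|⁴` for ALL `z ≠ 0` (homogeneity of degree `−4`; Gilbarg–Trudinger (2.14));
* `norm_fderiv2_newtonFar_sub_le_of_segment` — mean value inequality: if the segment `[z₁, z₂]` stays at distance `≥ ρ > r₁` from
  the origin then `‖D²Γ∞(z₂) − D²Γ∞(z₁)‖ ≤ (c/ρ⁴)‖z₂ − z₁‖` (there `D²Γ∞ = D²Γ`, `D³Γ∞ = D³Γ`);
* `norm_sub_two_mul_le_of_mem_segment` — for `x, x' ∈ B̄(a,2R)` every point of the segment `[x − y, x' − y]` has norm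
  `≥ |y − a| − 2R`;
* `abs_fderiv2_newtonFar_apply_sub_le` — the packaged estimate: for `0 < r₀ < r₁ ≤ R`, `x, x' ∈ B̄(a,2R)`, `|y − a| ≥ 4R` and any
  vector `w`, `|D²Γ∞(x − y)(w,w) − D²Γ∞(x' − y)(w,w)| ≤ 64·c·R·|y − a|⁻⁴·|w|²` — the dyadic rate that makes the oscillation of the
  harmonic remainder over `B̄(a,2R)` summable against bounded data (sibling file `…SparseEnergyFarOscillation`).

WHAT THIS IS NOT: not a claim about Navier–Stokes; potential theory of the Newtonian kernel (bears_on LADDER-NS N0 via crux 19708,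
line sparse_energy, stub S1). [folklore]
-/

noncomputable section

-- the summit and its single sub-problem share the name (CONVENTIONS §1), as in every Theorems file
set_option linter.dupNamespace false

namespace Summit.NavierStokesRegularity.NavierStokesRegularity.Theorems.PoloidalWindowDoorPoloidalWindowRigiditySparseEnergyFarKernel

-- nested operator types `ℝ³ →L[ℝ] ℝ³ →L[ℝ] ℝ³ →L[ℝ] ℝ`
set_option maxSynthPendingDepth 3

open MeasureTheory Set Function Filter Topology Metric
open Literature.Analysis Literature.Analysis.FluidPDE

/-- **`‖D³Γ(z)‖ ≤ c/|z|⁴` for every `z ≠ 0`** (the third derivative of the Newtonian kernel is homogeneous of degree `−4` and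
continuous on the unit sphere). [folklore] -/
theorem exists_norm_fderiv3_newtonKernel_le :
    ∃ c : ℝ, 0 ≤ c ∧ ∀ z : EuclideanSpace ℝ (Fin 3), z ≠ 0 →
      ‖fderiv ℝ (fderiv ℝ (fderiv ℝ newtonKernel)) z‖ ≤ c / ‖z‖ ^ 4 := by
  obtain ⟨M, hM⟩ := exists_bound_of_homogeneous _ (-4) (by norm_num) fderiv3_newtonKernel_homogeneous
    (contDiffOn_fderiv3_newtonKernel (n := 0)).continuousOn one_pos
  refine ⟨max M 0, le_max_right _ _, fun z hz => ?_⟩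
  set Φ := fderiv ℝ (fderiv ℝ (fderiv ℝ newtonKernel)) with hΦ
  have hz0 : 0 < ‖z‖ := norm_pos_iff.2 hz
  set w : EuclideanSpace ℝ (Fin 3) := ‖z‖⁻¹ • z with hw
  have hwn : ‖w‖ = 1 := by
    rw [hw, norm_smul, norm_inv, norm_norm, inv_mul_cancel₀ hz0.ne']
  have hzw : z = ‖z‖ • w := by rw [hw, smul_smul, mul_inv_cancel₀ hz0.ne', one_smul]
  have key : ‖Φ z‖ = ‖z‖ ^ (-4 : ℤ) * ‖Φ w‖ := by
    conv_lhs => rw [hzw, hΦ, fderiv3_newtonKernel_homogeneous _ hz0 w]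
    rw [norm_smul, norm_zpow, norm_norm]
  have hz4 : ‖z‖ ^ (-4 : ℤ) = (‖z‖ ^ 4)⁻¹ := by
    rw [show (-4 : ℤ) = -((4 : ℕ) : ℤ) by norm_num, zpow_neg, zpow_natCast]
  rw [key, hz4, div_eq_mul_inv, mul_comm]
  exact mul_le_mul_of_nonneg_right ((hM w hwn.ge).trans (le_max_left _ _)) (by positivity)

/-- **Mean value inequality for `D²Γ∞` along a far segment.**  Let `0 < r₀ < r₁ < ρ` and let the segment `[z₁, z₂]` stay at
distance `≥ ρ` from the origin; there `Γ∞ = Γ` with all derivatives, so `‖D²Γ∞(z₂) − D²Γ∞(z₁)‖ ≤ (c/ρ⁴)·‖z₂ − z₁‖` with the constant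
of `exists_norm_fderiv3_newtonKernel_le`. [folklore] -/
theorem norm_fderiv2_newtonFar_sub_le_of_segment {r₀ r₁ ρ : ℝ} (h₀ : 0 < r₀) (h₁ : r₀ < r₁) (hρ : r₁ < ρ) {c : ℝ}
    (hc0 : 0 ≤ c) (hc : ∀ z : EuclideanSpace ℝ (Fin 3), z ≠ 0 → ‖fderiv ℝ (fderiv ℝ (fderiv ℝ newtonKernel)) z‖ ≤ c / ‖z‖ ^ 4)
    {z₁ z₂ : EuclideanSpace ℝ (Fin 3)} (hseg : ∀ z ∈ segment ℝ z₁ z₂, ρ ≤ ‖z‖) :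
    ‖fderiv ℝ (fderiv ℝ (newtonFar r₀ r₁)) z₂ - fderiv ℝ (fderiv ℝ (newtonFar r₀ r₁)) z₁‖ ≤ c / ρ ^ 4 * ‖z₂ - z₁‖ := by
  set K := fderiv ℝ (fderiv ℝ (newtonFar r₀ r₁)) with hK
  have hρ0 : 0 < ρ := (h₀.trans h₁).trans hρ
  have hKd : Differentiable ℝ K := (contDiff_fderiv2_newtonFar h₀ h₁).differentiable two_ne_zero
  have hdiff : ∀ z ∈ segment ℝ z₁ z₂, DifferentiableAt ℝ K z := fun z _ => hKd z
  have hbound : ∀ z ∈ segment ℝ z₁ z₂, ‖fderiv ℝ K z‖ ≤ c / ρ ^ 4 := by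
    intro z hz
    have hzρ := hseg z hz
    have hz1 : r₁ < ‖z‖ := hρ.trans_le hzρ
    have hz0 : z ≠ 0 := by
      intro h
      rw [h, norm_zero] at hzρ
      linarith
    rw [hK, (newtonFar_fderiv_iterates_eq h₀.le h₁ hz1).2.2.2.1]
    calc ‖fderiv ℝ (fderiv ℝ (fderiv ℝ newtonKernel)) z‖ ≤ c / ‖z‖ ^ 4 := hc z hz0
      _ ≤ c / ρ ^ 4 := by
          apply div_le_div_of_nonneg_left hc0 (by positivity)
          exact pow_le_pow_left₀ hρ0.le hzρ 4
  exact (convex_segment z₁ z₂).norm_image_sub_le_of_norm_fderiv_le hdiff hbound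
    (left_mem_segment ℝ z₁ z₂) (right_mem_segment ℝ z₁ z₂)

/-- **Segments between far difference vectors stay far.**  If `x, x' ∈ B̄(a,2R)` then every point of the segment
`[x − y, x' − y]` has norm at least `|y − a| − 2R`. [folklore] -/
theorem norm_sub_two_mul_le_of_mem_segment {a x x' y : EuclideanSpace ℝ (Fin 3)} {R : ℝ}
    (hx : x ∈ closedBall a (2 * R)) (hx' : x' ∈ closedBall a (2 * R)) {z : EuclideanSpace ℝ (Fin 3)}
    (hz : z ∈ segment ℝ (x - y) (x' - y)) : ‖y - a‖ - 2 * R ≤ ‖z‖ := by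
  obtain ⟨θ₁, θ₂, hθ₁, hθ₂, hsum, rfl⟩ := hz
  rw [mem_closedBall, dist_eq_norm] at hx hx'
  set q : EuclideanSpace ℝ (Fin 3) := θ₁ • (x - a) + θ₂ • (x' - a) with hq
  have he : θ₁ • (x - y) + θ₂ • (x' - y) = q - (y - a) := by
    have h1 : θ₁ • (x - y) + θ₂ • (x' - y) = (θ₁ • x + θ₂ • x') - (θ₁ + θ₂) • y := by
      rw [smul_sub, smul_sub, add_smul]; abel
    have h2 : q = (θ₁ • x + θ₂ • x') - (θ₁ + θ₂) • a := by
      rw [hq, smul_sub, smul_sub, add_smul]; abel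
    rw [h1, h2, hsum, one_smul, one_smul]; abel
  have hqn : ‖q‖ ≤ 2 * R := by
    calc ‖q‖ ≤ ‖θ₁ • (x - a)‖ + ‖θ₂ • (x' - a)‖ := norm_add_le _ _
      _ = θ₁ * ‖x - a‖ + θ₂ * ‖x' - a‖ := by
          rw [norm_smul, norm_smul, Real.norm_of_nonneg hθ₁, Real.norm_of_nonneg hθ₂]
      _ ≤ θ₁ * (2 * R) + θ₂ * (2 * R) := by gcongr
      _ = 2 * R := by rw [← add_mul, hsum, one_mul]
  rw [he]
  have h := norm_sub_norm_le (y - a) q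
  rw [← norm_neg (y - a - q), neg_sub] at h
  linarith

/-- **The far kernel is Lipschitz at the dyadic rate.**  For `0 < r₀ < r₁ ≤ R`, `x, x' ∈ B̄(a,2R)`, `|y − a| ≥ 4R` and every vector
`w`: `|D²Γ∞^{r₀,r₁}(x − y)(w,w) − D²Γ∞^{r₀,r₁}(x' − y)(w,w)| ≤ 64·c·R·|y − a|⁻⁴·|w|²` (the segment `[x − y, x' − y]` stays at distance
`≥ |y − a| − 2R ≥ |y − a|/2 ≥ 2R > r₁` from the origin, `‖x − x'‖ ≤ 4R`). [folklore] -/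
theorem abs_fderiv2_newtonFar_apply_sub_le {r₀ r₁ R : ℝ} (h₀ : 0 < r₀) (h₁ : r₀ < r₁) (hR : r₁ ≤ R) {c : ℝ} (hc0 : 0 ≤ c)
    (hc : ∀ z : EuclideanSpace ℝ (Fin 3), z ≠ 0 → ‖fderiv ℝ (fderiv ℝ (fderiv ℝ newtonKernel)) z‖ ≤ c / ‖z‖ ^ 4)
    {a x x' y : EuclideanSpace ℝ (Fin 3)} (hx : x ∈ closedBall a (2 * R)) (hx' : x' ∈ closedBall a (2 * R))
    (hy : 4 * R ≤ ‖y - a‖) (w : EuclideanSpace ℝ (Fin 3)) :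
    |fderiv ℝ (fderiv ℝ (newtonFar r₀ r₁)) (x - y) w w - fderiv ℝ (fderiv ℝ (newtonFar r₀ r₁)) (x' - y) w w| ≤
      64 * c * R / ‖y - a‖ ^ 4 * ‖w‖ ^ 2 := by
  set K := fderiv ℝ (fderiv ℝ (newtonFar r₀ r₁)) with hK
  have hRpos : 0 < R := (h₀.trans h₁).trans_le hR
  have hya : 0 < ‖y - a‖ := by linarith
  set ρ : ℝ := ‖y - a‖ - 2 * R with hρ
  have hρr : r₁ < ρ := by rw [hρ]; linarith
  have hρhalf : ‖y - a‖ / 2 ≤ ρ := by rw [hρ]; linarith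
  have hρ0 : 0 < ρ := (h₀.trans h₁).trans hρr
  have hseg : ∀ z ∈ segment ℝ (x - y) (x' - y), ρ ≤ ‖z‖ := fun z hz => norm_sub_two_mul_le_of_mem_segment hx hx' hz
  have hmv := norm_fderiv2_newtonFar_sub_le_of_segment h₀ h₁ hρr hc0 hc hseg
  -- `‖x' − y − (x − y)‖ = ‖x' − x‖ ≤ 4R`
  have hxx : ‖x' - y - (x - y)‖ ≤ 4 * R := by
    rw [show x' - y - (x - y) = (x' - a) - (x - a) by abel]
    rw [mem_closedBall, dist_eq_norm] at hx hx'
    calc ‖x' - a - (x - a)‖ ≤ ‖x' - a‖ + ‖x - a‖ := norm_sub_le _ _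
      _ ≤ 2 * R + 2 * R := add_le_add hx' hx
      _ = 4 * R := by ring
  -- `1/ρ⁴ ≤ 16/|y − a|⁴`
  have hρ4 : c / ρ ^ 4 ≤ 16 * c / ‖y - a‖ ^ 4 := by
    rw [div_le_div_iff₀ (by positivity) (by positivity)]
    have h2 : ‖y - a‖ ^ 4 ≤ (2 * ρ) ^ 4 := pow_le_pow_left₀ hya.le (by linarith) 4
    nlinarith [pow_nonneg hρ0.le 4]
  have hKdiff : ‖K (x' - y) - K (x - y)‖ ≤ 64 * c * R / ‖y - a‖ ^ 4 := by
    calc ‖K (x' - y) - K (x - y)‖ ≤ c / ρ ^ 4 * ‖x' - y - (x - y)‖ := hmv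
      _ ≤ 16 * c / ‖y - a‖ ^ 4 * (4 * R) := by gcongr
      _ = 64 * c * R / ‖y - a‖ ^ 4 := by ring
  have happ : K (x - y) w w - K (x' - y) w w = (K (x - y) - K (x' - y)) w w := by
    simp only [sub_apply]
  rw [happ, ← Real.norm_eq_abs]
  calc ‖(K (x - y) - K (x' - y)) w w‖ ≤ ‖K (x - y) - K (x' - y)‖ * ‖w‖ * ‖w‖ := ContinuousLinearMap.le_opNorm₂ _ _ _
    _ = ‖K (x' - y) - K (x - y)‖ * ‖w‖ ^ 2 := by rw [← norm_neg (K (x - y) - K (x' - y)), neg_sub]; ring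
    _ ≤ 64 * c * R / ‖y - a‖ ^ 4 * ‖w‖ ^ 2 := by gcongr

end Summit.NavierStokesRegularity.NavierStokesRegularity.Theorems.PoloidalWindowDoorPoloidalWindowRigiditySparseEnergyFarKernel

end
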